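import Literature.AlgebraicGeometry.Shioda1982.ExceptionalQuadruplesComplete
import HarnessLib

/-!
# Shioda 1982 / Meyer–Neutsch 1981: no exceptional quadruple at the levels `114 ≤ N ≤ 121` absent from Tabelle 1 (kernel sweep)

Topic `Literature/AlgebraicGeometry/Shioda1982`; companion of `ExceptionalQuadruplesComplete.lean` (search `checkB`, soundness
`tabelleOneCompleteAt_of_chunks`, invariant form `exists_mem_reps_of_isExceptionalQuadruple`, statement `TabelleOneCompleteAt`; sources,
method and framing in its module docstring), of the sweeps `ExceptionalQuadruplesSweepSixty/…/Ninety.lean` (all `2 ≤ N ≤ 90`),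
`…SweepOneHundredTwelve.lean` (`N = 112`), `…SweepOneHundredThirtyTwo.lean` (`N = 132`) and of the other files of this series
(`ExceptionalQuadruplesSweep<lo>To<hi>.lean`, together: every level `91 ≤ N ≤ 179` that is not a row of Tabelle 1). THEOREMS only (no
definition, no named fact): the kernel search at each level `N` of this file's range that carries NO row of
[MeyerNeutsch1981Fermatquadrupel, Tabelle 1] (computer-generated there, "alle Fermatquadrupel für N ≤ 614 ermittelt", §2 p. 53; zeros of
[Shioda1982PicardFermat, table p. 727], whose non-zero entries `N ≤ 180` are exactly the 22 table levels): `completeAt_<N>` (every sorted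
pair-free primitive Hodge 4-multiset mod `N` is standard) and `not_isExceptionalQuadruple_<N>`. With the table levels
(`ExceptionalQuadruplesComplete*.lean`: the printed list is complete at each of its 22 levels `≤ 180`) the series makes Meyer–Neutsch's
classification of the exceptional surface classes kernel-certified at EVERY level `N ≤ 180`; above `180` there are none by Aoki's
Theorem C ([Aoki1983], computer-assisted for `181 ≤ m ≤ 672`, not a kernel statement). `decide +kernel` only (no `native_decide`),
chunked by first entries to bound the memory of a single kernel evaluation (≈ 0.9 ms of kernel time per candidate triple; this file
visits 324987 candidates).

HONEST FRAMING (cell `pub-hfermat`): explicit algebraic cycles for specific Hodge classes on Fermat/Delsarte varieties; residual open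
instances listed; no claim on general Hodge. These classes are algebraic (Lefschetz (1,1)); certified here is only the emptiness of the
exceptional list at these levels.

## References
* [MeyerNeutsch1981Fermatquadrupel] W. Meyer, W. Neutsch, *Fermatquadrupel*, Math. Ann. 256 (1981) 51–62, §2 p. 53, Tabelle 1 p. 54 (no rows 114, 115, 116, 117, 118, 119, 121).
* [Shioda1982PicardFermat] T. Shioda, J. Fac. Sci. Univ. Tokyo IA 28 (1982) 725–734, table p. 727.
* [Aoki1983] N. Aoki, Math. Ann. 266 (1983) 23–54, Thm. C.
-/

namespace Literature.AlgebraicGeometry.Shioda1982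

open Literature.AlgebraicGeometry.HodgeTheory

set_option maxHeartbeats 0 in
/-- **Tabelle 1 is complete at `N = 114`, where it is empty**: every sorted Hodge 4-multiset mod `114` without a pair and with
`gcd = 1` is standard. Kernel exhaustion (`checkB`, 2 chunks of first entries, 42788 candidate triples).
[cite: MeyerNeutsch1981Fermatquadrupel, §2 p. 53 ("alle Fermatquadrupel für N ≤ 614 ermittelt") and Tabelle 1 p. 54 (no row 114)]
[cite: Shioda1982PicardFermat, table p. 727] -/
theorem completeAt_oneHundredFourteen : TabelleOneCompleteAt 114 :=
  tabelleOneCompleteAt_of_chunks 114 [(0, 21), (21, 93)] (by decide +kernel) (by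
    intro p hp
    simp only [List.mem_cons, List.not_mem_nil, or_false] at hp
    rcases hp with rfl | rfl <;> decide +kernel)

set_option maxHeartbeats 0 in
/-- **Tabelle 1 is complete at `N = 115`, where it is empty**: every sorted Hodge 4-multiset mod `115` without a pair and with
`gcd = 1` is standard. Kernel exhaustion (`checkB`, 2 chunks of first entries, 43909 candidate triples).
[cite: MeyerNeutsch1981Fermatquadrupel, §2 p. 53 ("alle Fermatquadrupel für N ≤ 614 ermittelt") and Tabelle 1 p. 54 (no row 115)]
[cite: Shioda1982PicardFermat, table p. 727] -/
theorem completeAt_oneHundredFifteen : TabelleOneCompleteAt 115 :=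
  tabelleOneCompleteAt_of_chunks 115 [(0, 21), (21, 94)] (by decide +kernel) (by
    intro p hp
    simp only [List.mem_cons, List.not_mem_nil, or_false] at hp
    rcases hp with rfl | rfl <;> decide +kernel)

set_option maxHeartbeats 0 in
/-- **Tabelle 1 is complete at `N = 116`, where it is empty**: every sorted Hodge 4-multiset mod `116` without a pair and with
`gcd = 1` is standard. Kernel exhaustion (`checkB`, 2 chunks of first entries, 45050 candidate triples).
[cite: MeyerNeutsch1981Fermatquadrupel, §2 p. 53 ("alle Fermatquadrupel für N ≤ 614 ermittelt") and Tabelle 1 p. 54 (no row 116)]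
[cite: Shioda1982PicardFermat, table p. 727] -/
theorem completeAt_oneHundredSixteen : TabelleOneCompleteAt 116 :=
  tabelleOneCompleteAt_of_chunks 116 [(0, 20), (20, 96)] (by decide +kernel) (by
    intro p hp
    simp only [List.mem_cons, List.not_mem_nil, or_false] at hp
    rcases hp with rfl | rfl <;> decide +kernel)

set_option maxHeartbeats 0 in
/-- **Tabelle 1 is complete at `N = 117`, where it is empty**: every sorted Hodge 4-multiset mod `117` without a pair and with
`gcd = 1` is standard. Kernel exhaustion (`checkB`, 2 chunks of first entries, 46210 candidate triples).
[cite: MeyerNeutsch1981Fermatquadrupel, §2 p. 53 ("alle Fermatquadrupel für N ≤ 614 ermittelt") and Tabelle 1 p. 54 (no row 117)]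
[cite: Shioda1982PicardFermat, table p. 727] -/
theorem completeAt_oneHundredSeventeen : TabelleOneCompleteAt 117 :=
  tabelleOneCompleteAt_of_chunks 117 [(0, 20), (20, 97)] (by decide +kernel) (by
    intro p hp
    simp only [List.mem_cons, List.not_mem_nil, or_false] at hp
    rcases hp with rfl | rfl <;> decide +kernel)

set_option maxHeartbeats 0 in
/-- **Tabelle 1 is complete at `N = 118`, where it is empty**: every sorted Hodge 4-multiset mod `118` without a pair and with
`gcd = 1` is standard. Kernel exhaustion (`checkB`, 2 chunks of first entries, 47390 candidate triples).
[cite: MeyerNeutsch1981Fermatquadrupel, §2 p. 53 ("alle Fermatquadrupel für N ≤ 614 ermittelt") and Tabelle 1 p. 54 (no row 118)]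
[cite: Shioda1982PicardFermat, table p. 727] -/
theorem completeAt_oneHundredEighteen : TabelleOneCompleteAt 118 :=
  tabelleOneCompleteAt_of_chunks 118 [(0, 20), (20, 98)] (by decide +kernel) (by
    intro p hp
    simp only [List.mem_cons, List.not_mem_nil, or_false] at hp
    rcases hp with rfl | rfl <;> decide +kernel)

set_option maxHeartbeats 0 in
/-- **Tabelle 1 is complete at `N = 119`, where it is empty**: every sorted Hodge 4-multiset mod `119` without a pair and with
`gcd = 1` is standard. Kernel exhaustion (`checkB`, 2 chunks of first entries, 48590 candidate triples).
[cite: MeyerNeutsch1981Fermatquadrupel, §2 p. 53 ("alle Fermatquadrupel für N ≤ 614 ermittelt") and Tabelle 1 p. 54 (no row 119)]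
[cite: Shioda1982PicardFermat, table p. 727] -/
theorem completeAt_oneHundredNineteen : TabelleOneCompleteAt 119 :=
  tabelleOneCompleteAt_of_chunks 119 [(0, 19), (19, 100)] (by decide +kernel) (by
    intro p hp
    simp only [List.mem_cons, List.not_mem_nil, or_false] at hp
    rcases hp with rfl | rfl <;> decide +kernel)

set_option maxHeartbeats 0 in
/-- **Tabelle 1 is complete at `N = 121`, where it is empty**: every sorted Hodge 4-multiset mod `121` without a pair and with
`gcd = 1` is standard. Kernel exhaustion (`checkB`, 3 chunks of first entries, 51050 candidate triples).
[cite: MeyerNeutsch1981Fermatquadrupel, §2 p. 53 ("alle Fermatquadrupel für N ≤ 614 ermittelt") and Tabelle 1 p. 54 (no row 121)]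
[cite: Shioda1982PicardFermat, table p. 727] -/
theorem completeAt_oneHundredTwentyOne : TabelleOneCompleteAt 121 :=
  tabelleOneCompleteAt_of_chunks 121 [(0, 19), (19, 28), (47, 74)] (by decide +kernel) (by
    intro p hp
    simp only [List.mem_cons, List.not_mem_nil, or_false] at hp
    rcases hp with rfl | rfl | rfl <;> decide +kernel)

/-- **No exceptional quadruple ("Ausnahmequadrupel") at the level `114`** (`tabelleOne 114 = []`).
[cite: MeyerNeutsch1981Fermatquadrupel, Tabelle 1 p. 54 (no row 114)] [cite: Shioda1982PicardFermat, table p. 727] -/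
theorem not_isExceptionalQuadruple_oneHundredFourteen (s : Multiset (ZMod 114)) : ¬ IsExceptionalQuadruple 114 s := by
  intro hs
  obtain ⟨r, hr, -⟩ := exists_mem_reps_of_isExceptionalQuadruple completeAt_oneHundredFourteen hs
  simp [reps, tabelleOne] at hr

/-- **No exceptional quadruple ("Ausnahmequadrupel") at the level `115`** (`tabelleOne 115 = []`).
[cite: MeyerNeutsch1981Fermatquadrupel, Tabelle 1 p. 54 (no row 115)] [cite: Shioda1982PicardFermat, table p. 727] -/
theorem not_isExceptionalQuadruple_oneHundredFifteen (s : Multiset (ZMod 115)) : ¬ IsExceptionalQuadruple 115 s := by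
  intro hs
  obtain ⟨r, hr, -⟩ := exists_mem_reps_of_isExceptionalQuadruple completeAt_oneHundredFifteen hs
  simp [reps, tabelleOne] at hr

/-- **No exceptional quadruple ("Ausnahmequadrupel") at the level `116`** (`tabelleOne 116 = []`).
[cite: MeyerNeutsch1981Fermatquadrupel, Tabelle 1 p. 54 (no row 116)] [cite: Shioda1982PicardFermat, table p. 727] -/
theorem not_isExceptionalQuadruple_oneHundredSixteen (s : Multiset (ZMod 116)) : ¬ IsExceptionalQuadruple 116 s := by
  intro hs
  obtain ⟨r, hr, -⟩ := exists_mem_reps_of_isExceptionalQuadruple completeAt_oneHundredSixteen hs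
  simp [reps, tabelleOne] at hr

/-- **No exceptional quadruple ("Ausnahmequadrupel") at the level `117`** (`tabelleOne 117 = []`).
[cite: MeyerNeutsch1981Fermatquadrupel, Tabelle 1 p. 54 (no row 117)] [cite: Shioda1982PicardFermat, table p. 727] -/
theorem not_isExceptionalQuadruple_oneHundredSeventeen (s : Multiset (ZMod 117)) : ¬ IsExceptionalQuadruple 117 s := by
  intro hs
  obtain ⟨r, hr, -⟩ := exists_mem_reps_of_isExceptionalQuadruple completeAt_oneHundredSeventeen hs
  simp [reps, tabelleOne] at hr

/-- **No exceptional quadruple ("Ausnahmequadrupel") at the level `118`** (`tabelleOne 118 = []`).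
[cite: MeyerNeutsch1981Fermatquadrupel, Tabelle 1 p. 54 (no row 118)] [cite: Shioda1982PicardFermat, table p. 727] -/
theorem not_isExceptionalQuadruple_oneHundredEighteen (s : Multiset (ZMod 118)) : ¬ IsExceptionalQuadruple 118 s := by
  intro hs
  obtain ⟨r, hr, -⟩ := exists_mem_reps_of_isExceptionalQuadruple completeAt_oneHundredEighteen hs
  simp [reps, tabelleOne] at hr

/-- **No exceptional quadruple ("Ausnahmequadrupel") at the level `119`** (`tabelleOne 119 = []`).
[cite: MeyerNeutsch1981Fermatquadrupel, Tabelle 1 p. 54 (no row 119)] [cite: Shioda1982PicardFermat, table p. 727] -/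
theorem not_isExceptionalQuadruple_oneHundredNineteen (s : Multiset (ZMod 119)) : ¬ IsExceptionalQuadruple 119 s := by
  intro hs
  obtain ⟨r, hr, -⟩ := exists_mem_reps_of_isExceptionalQuadruple completeAt_oneHundredNineteen hs
  simp [reps, tabelleOne] at hr

/-- **No exceptional quadruple ("Ausnahmequadrupel") at the level `121`** (`tabelleOne 121 = []`).
[cite: MeyerNeutsch1981Fermatquadrupel, Tabelle 1 p. 54 (no row 121)] [cite: Shioda1982PicardFermat, table p. 727] -/
theorem not_isExceptionalQuadruple_oneHundredTwentyOne (s : Multiset (ZMod 121)) : ¬ IsExceptionalQuadruple 121 s := by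
  intro hs
  obtain ⟨r, hr, -⟩ := exists_mem_reps_of_isExceptionalQuadruple completeAt_oneHundredTwentyOne hs
  simp [reps, tabelleOne] at hr

end Literature.AlgebraicGeometry.Shioda1982
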